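import Literature.Topology.FourManifolds.HCobordismWallDualityProofs
import Literature.AlgebraicTopology.SingularHomology.ClosedBallSphereHomology
import Literature.AlgebraicTopology.SingularHomology.LocalHomologyVanishing
import Literature.AlgebraicTopology.SingularHomology.SimplyConnectedH1
import HarnessLib

/-!
# Wall's Theorem 2 along its printed proof: "Hence `Hₖ(R, Mᵢ) = 0` for `k ≤ 2` … and `R` is
# indeed an h-cobordism" — PROVED, in the form a construction of `R` has to meet

Topic `Literature/Topology/FourManifolds`; sibling proof file of `HCobordismWallDuality.lean` /
`HCobordismWallDualityProofs.lean` in the cone of the named fact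
`Literature.Topology.FourManifolds.isHCobordant_of_equivalent_intersectionForm` (**Wall 1964,
Thm. 2**: closed smooth simply connected 4-manifolds with isometric intersection forms are
h-cobordant; C. T. C. Wall, *On simply-connected 4-manifolds*, J. London Math. Soc. 39 (1964)
141–149; `HCobordismDonaldson.lean`).

The last paragraph of the proof of Thm. 2 (p. 146) reads: "First, it is clear from construction
that `R` is simply-connected. … we see that the induced maps `H₂(M₁) → H₂(R)` and `H₂(M₂) → H₂(R)`
are isomorphisms … Hence `Hₖ(R, Mᵢ) = 0` for `k ≤ 2` and `i = 1, 2`, and so also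
`Hₖ(R, M₁) ≅ H⁵⁻ᵏ(R, M₂) = 0`, so that all the relative homology groups vanish, and `R` is indeed
an h-cobordism." The tree proves "and so also … h-cobordism" outright
(`isHCobordant_of_isZero_relativeSingularHomology_le_two`, `HCobordismWallDualityProofs.lean`:
Lefschetz duality for the triad, universal coefficients, Whitehead's theorem, CW type of compact
manifolds — all discharged). This file proves the word "Hence" and records the resulting
recognition theorem in the exact form a construction of Wall's `R` has to meet:

* `isZero_relativeSingularHomology_of_le_two_of_epi` — **"Hence `Hₖ(R, Mᵢ) = 0` for `k ≤ 2`"**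
  for a pair: if `X` is simply connected, `A ⊆ X` is simply connected (as a space) and
  `H₂(A; ℤ) → H₂(X; ℤ)` is ONTO, then `Hₖ(X, A; ℤ) = 0` for `k ≤ 2` (exact sequence of the pair,
  Hatcher Thm. 2.16: `k = 2` from `H₂(A) ↠ H₂(X)` and `H₁(A) = 0`; `k = 1` from `H₁(X) = 0` and
  `H₀(A) ↪ H₀(X)`; `k = 0` from `H₀(A) ↠ H₀(X)`; `H₁ = 0` of simply connected spaces is Hatcher
  Thm. 2A.1, the tree's `isZero_singularHomology_one_of_simplyConnectedSpace`). Only the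
  SURJECTIVITY half of Wall's "isomorphisms" is consumed.
* `Cobordism.isHCobordism_of_epi_singularHomologyMap_two` — **Wall's recognition of `R`,
  outright**: a cobordism `R` between simply connected compact 4-manifolds `M`, `N` whose total
  space is simply connected and onto whose `H₂(-; ℤ)` both ends map surjectively
  (`Epi (inl_* : H₂(M) → H₂(R))`, `Epi (inr_*)`) is an h-cobordism; hence `M`, `N` are h-cobordant
  (`isHCobordant_of_epi_singularHomologyMap_two`). No hypothesis beyond the cobordism and the two
  epimorphisms: this is what the re-gluing `R = C ∪ V ∪ (D⁴ × I)` of pp. 145–146 (Thm. 1, Lemma 2,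
  [10], [11], van Kampen and Mayer–Vietoris) has to deliver for the pair `(M₁, M₂)`.

Everything is proved; no named fact and no definition is introduced; nothing in the tree is
restated (the pair lemma is the degreewise combination of the tree's exact-sequence lemmas, the
cobordism theorems feed it into `Cobordism.isHCobordism_of_isZero_relativeSingularHomology_le_two'`).

## References

* C. T. C. Wall, *On simply-connected 4-manifolds*, J. London Math. Soc. 39 (1964) 141–149, §2
  p. 146. [WallJLMS1964]
* A. Hatcher, *Algebraic Topology*, CUP (2002), §2.1 Thm. 2.16 (exact sequence of the pair),
  Prop. 2.7, §2.A Thm. 2A.1. [HatcherAT2002]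
-/

open scoped Manifold ContDiff
open CategoryTheory CategoryTheory.Limits Set
open Literature.AlgebraicTopology.SingularHomology

noncomputable section

universe u

namespace Literature.Topology.FourManifolds

/-! ### "Hence `Hₖ(R, Mᵢ) = 0` for `k ≤ 2`" for a pair -/

section Pair

variable {X : Type u} [TopologicalSpace X]

/-- **"Hence `Hₖ(R, Mᵢ) = 0` for `k ≤ 2`"** (Wall 1964, p. 146), for a pair `(X, A)`: if `X` and
the subspace `A` are simply connected and `H₂(A; ℤ) → H₂(X; ℤ)` is onto, then `Hₖ(X, A; ℤ) = 0`
for `k ≤ 2`. Exact sequence of the pair (Hatcher Thm. 2.16): in degree `2`,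
`H₂(A) ↠ H₂(X) → H₂(X, A) → H₁(A) = 0`; in degree `1`, `H₁(X) = 0 → H₁(X, A) → H₀(A) ↪ H₀(X)`
(`A` path connected, Prop. 2.7); in degree `0`, `H₀(A) ↠ H₀(X) ↠ H₀(X, A)`; with `H₁ = 0` for
simply connected spaces (Thm. 2A.1). PROVED from the tree's exact-sequence lemmas.
[cite: WallJLMS1964, §2 p. 146] [cite: HatcherAT2002, §2.1 Thm. 2.16, Prop. 2.7, Thm. 2A.1] -/
theorem isZero_relativeSingularHomology_of_le_two_of_epi [SimplyConnectedSpace X] (A : Set X)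
    [SimplyConnectedSpace A]
    [Epi (singularHomology.map ℤ ℤ (⟨Subtype.val, continuous_subtype_val⟩ : C(A, X)) 2)]
    (k : ℕ) (hk : k ≤ 2) : IsZero (relativeSingularHomology ℤ ℤ X A k) := by
  interval_cases k
  · -- degree 0: `A` is nonempty and `X` is path connected
    obtain ⟨a⟩ := (inferInstance : Nonempty A)
    exact isZero_relativeSingularHomology_zero_of_pathConnectedSpace ℤ ℤ A ⟨a, a.2⟩
  · -- degree 1: `H₁(X) = 0` and `A` is path connected
    exact isZero_relativeSingularHomology_one_of_pathConnectedSpace ℤ ℤ A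
      (isZero_singularHomology_one_of_simplyConnectedSpace ℤ ℤ)
  · -- degree 2: `H₂(A) → H₂(X)` onto and `H₁(A) = 0`
    haveI : Mono (singularHomology.map ℤ ℤ (⟨Subtype.val, continuous_subtype_val⟩ : C(A, X)) 1) :=
      (isZero_singularHomology_one_of_simplyConnectedSpace ℤ ℤ
        (X := A)).mono _
    exact isZero_relativeSingularHomology_succ_of_epi_of_mono ℤ ℤ A 1

variable {M : Type u} [TopologicalSpace M]

/-- **Surjectivity on `Hₖ` passes from an embedding to the inclusion of its range**: if
`f : M → X` is an embedding and `f_* : Hₖ(M) → Hₖ(X)` is onto, so is `Hₖ(range f) → Hₖ(X)` (`f`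
is the homeomorphism `M ≃ₜ range f` followed by the inclusion; Hatcher 2002, §2.1).
[cite: HatcherAT2002, §2.1 (remark after Prop. 2.9)] -/
theorem epi_singularHomologyMap_subtypeVal_of_epi {f : M → X} (hf : Topology.IsEmbedding f)
    (k : ℕ) [Epi (singularHomology.map ℤ ℤ (⟨f, hf.continuous⟩ : C(M, X)) k)] :
    Epi (singularHomology.map ℤ ℤ (⟨Subtype.val, continuous_subtype_val⟩ : C(range f, X)) k) := by
  let e : M ≃ₜ range f := hf.toHomeomorph
  have hfac : (⟨f, hf.continuous⟩ : C(M, X)) =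
      (⟨Subtype.val, continuous_subtype_val⟩ : C(range f, X)).comp (e : C(M, range f)) := by
    ext x
    exact (hf.toHomeomorph_apply_coe x).symm
  have h : Epi (singularHomology.map ℤ ℤ (e : C(M, range f)) k ≫
      singularHomology.map ℤ ℤ (⟨Subtype.val, continuous_subtype_val⟩ : C(range f, X)) k) := by
    rw [← singularHomology.map_comp, ← hfac]
    infer_instance
  exact epi_of_epi (singularHomology.map ℤ ℤ (e : C(M, range f)) k) _

/-- The range of an embedding of a simply connected space is simply connected (it is homeomorphic
to it). [folklore] -/
theorem simplyConnectedSpace_range_of_isEmbedding [SimplyConnectedSpace M] {f : M → X}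
    (hf : Topology.IsEmbedding f) : SimplyConnectedSpace (range f) :=
  hf.toHomeomorph.symm.toHomotopyEquiv.simplyConnectedSpace

end Pair

/-! ### Wall's recognition of `R`, outright -/

section Recognition

variable {M N : Type u} [TopologicalSpace M] [T2Space M] [CompactSpace M]
  [ChartedSpace (EuclideanSpace ℝ (Fin 4)) M] [SimplyConnectedSpace M] [TopologicalSpace N]
  [T2Space N] [CompactSpace N] [ChartedSpace (EuclideanSpace ℝ (Fin 4)) N] [SimplyConnectedSpace N]

/-- **Wall's recognition of the h-cobordism `R`, outright** (1964, p. 146: "it is clear from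
construction that `R` is simply-connected … the induced maps `H₂(M₁) → H₂(R)` and `H₂(M₂) → H₂(R)`
are isomorphisms … Hence `Hₖ(R, Mᵢ) = 0` for `k ≤ 2` … so that all the relative homology groups
vanish, and `R` is indeed an h-cobordism"): **a cobordism `R` between simply connected compact
Hausdorff 4-manifolds `M`, `N` with `R` simply connected and `H₂(M; ℤ) → H₂(R; ℤ)`,
`H₂(N; ℤ) → H₂(R; ℤ)` onto is an h-cobordism.** "Hence" is
`isZero_relativeSingularHomology_of_le_two_of_epi` for the pairs `(R, M)`, `(R, N)`; the rest is
the tree's `Cobordism.isHCobordism_of_isZero_relativeSingularHomology_le_two'` (Lefschetz duality,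
universal coefficients, Whitehead, CW type — all discharged). PROVED, no hypothesis beyond the
cobordism and the two epimorphisms. [cite: WallJLMS1964, §2 p. 146] [cite: HatcherAT2002, Thm. 2.16, Thm. 3.43, Cor. 4.33] -/
theorem Cobordism.isHCobordism_of_epi_singularHomologyMap_two (R : Cobordism 4 M N)
    [SimplyConnectedSpace R.W]
    (hM : Epi (singularHomology.map ℤ ℤ (⟨R.inl, R.continuous_inl⟩ : C(M, R.W)) 2))
    (hN : Epi (singularHomology.map ℤ ℤ (⟨R.inr, R.continuous_inr⟩ : C(N, R.W)) 2)) :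
    R.IsHCobordism := by
  haveI := simplyConnectedSpace_range_of_isEmbedding R.isSmoothEmbedding_inl.isEmbedding
  haveI := simplyConnectedSpace_range_of_isEmbedding R.isSmoothEmbedding_inr.isEmbedding
  haveI := epi_singularHomologyMap_subtypeVal_of_epi R.isSmoothEmbedding_inl.isEmbedding 2
  haveI := epi_singularHomologyMap_subtypeVal_of_epi R.isSmoothEmbedding_inr.isEmbedding 2
  exact R.isHCobordism_of_isZero_relativeSingularHomology_le_two' fun k hk =>
    ⟨isZero_relativeSingularHomology_of_le_two_of_epi (range R.inl) k hk,
      isZero_relativeSingularHomology_of_le_two_of_epi (range R.inr) k hk⟩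

/-- **Wall's Thm. 2 for one pair from a constructed `R`, outright** (1964, §2, pp. 145–146):
simply connected compact Hausdorff 4-manifolds `M`, `N` joined by a cobordism `R` with `R` simply
connected and `H₂(M; ℤ) → H₂(R; ℤ)`, `H₂(N; ℤ) → H₂(R; ℤ)` onto are h-cobordant
(`IsHCobordant 4 M N`) — the form in which the re-gluing `R = C ∪ V ∪ (D⁴ × I)` of Wall's proof
closes the frozen leaf `isHCobordant_of_equivalent_intersectionForm` (`HCobordismDonaldson.lean`)
for the pair at hand. PROVED. [cite: WallJLMS1964, Thm. 2 with §2, pp. 145–146] -/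
theorem isHCobordant_of_epi_singularHomologyMap_two (R : Cobordism 4 M N) [SimplyConnectedSpace R.W]
    (hM : Epi (singularHomology.map ℤ ℤ (⟨R.inl, R.continuous_inl⟩ : C(M, R.W)) 2))
    (hN : Epi (singularHomology.map ℤ ℤ (⟨R.inr, R.continuous_inr⟩ : C(N, R.W)) 2)) :
    IsHCobordant 4 M N :=
  ⟨R, R.isHCobordism_of_epi_singularHomologyMap_two hM hN⟩

end Recognition

end Literature.Topology.FourManifolds

end
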